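import Summits.QuantumAdvantage.QuantumAdvantage.Theses.CubicForrelation
import Summits.QuantumAdvantage.QuantumAdvantage.Theorems.ExactPairsMaioranaMcFarland.Negative.DillonCertificate
import Literature.Computability.QuantumComplexity.ForrelationDerivativeTables

/-!
# Line `lagrangian-pauli-sector` — skeleton for crux `CubicForrelation.ExactPairsMaioranaMcFarland`
(stmt-QuantumAdvantage-2205), crux-plan seat, 2026-08-16.

Crux (m = n/2): `f g : 𝔽₂^{m+m} → 𝔽₂` both of degree ≤ 3 with `forrelation f g = 1` (g bent with dual f)
⇒ `g` is in the completed Maiorana–McFarland class (`MMConclusionAt m g`, verbatim the crux's conclusion;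
`Negative.exactPairsMaioranaMcFarland_iff` is `Iff.rfl`).

PHASE-SPACE LINE.  Work on 𝔽₂ⁿ × 𝔽₂ⁿ (directions × frequencies) with the derivative–Walsh ("Pauli-sector")
table `K_g(a,u) = W_{D_a g}(u) = dwt (signOf ∘ g) a u`.  For a cubic pair BOTH tables `K_g`, `K_f` have
plateaued rows (derivatives of cubics are quadratic: Carlet 2020 Prop. 55, tree fact
`Literature.InformationTheory.Coding.carlet2020_prop55`) and they are TRANSPOSES of each other
(tree theorem `DerivativeWalsh.dwt_transpose_of_forrelation_sq_eq_one`), so `supp K_g` is a bi-affine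
incidence whose row `a` is a coset of `R_a(g)^⊥` and whose column `u` is a coset of `R_u(f)^⊥`, with MATCHED
radical dimensions on the support (`stub_rankMatch`).  Dillon's criterion in this language: `g ∈ MM#` iff some
LAGRANGIAN SECTOR `V × V^⊥` (dim V = m) carries the rows `a ∈ V` of `supp K_g` — then automatically the columns
`u ∈ V^⊥` too, and `V^⊥` is the Dillon subspace of the dual `f`.  The line splits the existence of the sector
into its two geometrically distinct halves:

* `stub_lagrangianFrame` (HARDEST, the trivector half "S1", symmetric in the pair): a Lagrangian FRAME exists —
  an m-dimensional `V` totally singular for the cubic form of `g` (all `D_aD_b g`, `a b ∈ V`, CONSTANT: rows of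
  `V` are parallel to `V^⊥`) whose orthogonal `V^⊥` is totally singular for the cubic form of `f` (columns).
  Must use that `f` is cubic: for PP20's `h^10_4` (cubic bent, quartic dual, `Disproof.g4`) the largest
  totally singular subspace has dimension 4 < 5 — this is where `exactPairsMaioranaMcFarland_false_without_fCubic`
  is honoured.
* `stub_sectorCentring` (the constants half "S2"): given a Lagrangian frame, some (possibly different)
  m-dimensional `V′` is CENTRED — all `D_aD_b g ≡ 0` on `V′` (Dillon subspace).  For quadratic `g` (T = 0,
  every frame qualifies) this is exactly the existence of a Lagrangian subspace of the symplectic form of `g`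
  (Dickson); in general it is the statement that the alternating DEFECT form `c_V(a,b) = D_aD_b g(0)` can be
  killed inside the variety of frames ("Witt index m" of the idea card's Transfer C⁺).
* `stub_dualPair` (`forrelation f g = 1` ⇒ `W_g = 2^m (-1)^f`, Cauchy–Schwarz/Parseval), `stub_rankMatch`
  (covariance + Prop. 55 ⇒ matched radical counts on the support) and `stub_dillonCriterion` (bent + Dillon
  subspace ⇒ MM normal form, Dillon 1974) are the known-but-unformalised frame of the argument; the first and
  last are where `exactPairsMaioranaMcFarland_false_without_forrelation` is honoured (bentness).

`mm_of_parts` composes the five stub STATEMENTS (as hypotheses) into the crux body, sorry-free and kernel-checked;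
`ExactPairsMaioranaMcFarland_of : ExactPairsMaioranaMcFarland` instantiates it with the registered stubs (crux BY NAME).
Landed negative lemmas imported: `Negative.DillonCertificate` (`not_MM_of_bigCountC_lt`, `mm_family`):
no stub is an instance they refute (all stubs are implied by the crux on cubic pairs, or are theorems in print).
-/

set_option linter.dupNamespace false
set_option linter.unusedVariables false

noncomputable section

namespace Summit.QuantumAdvantage.QuantumAdvantage.Cruxes.ExactPairsMaioranaMcFarland.LagrangianPauliSector

open Literature.Computability.QuantumComplexity
open Literature.Computability.QuantumComplexity.BuzetChailloux (bxor zeroVec)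
open Literature.Computability.QuantumComplexity.DerivativeWalsh (dwt W dwt_transpose_of_forrelation_sq_eq_one)
open Summit.QuantumAdvantage.QuantumAdvantage.Theorems.ExactPairsMaioranaMcFarland.Negative
  (MMConclusionAt exactPairsMaioranaMcFarland_iff)
open Summit.QuantumAdvantage.QuantumAdvantage.Theses.CubicForrelation (ExactPairsMaioranaMcFarland)

variable {n : ℕ}

/-! ### Vocabulary (phase-space reading of the crux's raw hypotheses) -/

/-- `g : 𝔽₂ⁿ → 𝔽₂` has algebraic degree `≤ 3` — verbatim the crux's hypothesis shape. -/
def IsCubic (g : (Fin n → Bool) → Bool) : Prop :=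
  ∃ p : MvPolynomial (Fin n) (ZMod 2), p.totalDegree ≤ 3 ∧
    ∀ x, g x = decide (MvPolynomial.eval (fun j => if x j then (1 : ZMod 2) else 0) p = 1)

/-- Second derivative `D_a D_b g (x) = g(x) ⊕ g(x ⊕ a) ⊕ g(x ⊕ b) ⊕ g(x ⊕ a ⊕ b)`. -/
def D2 (g : (Fin n → Bool) → Bool) (a b x : Fin n → Bool) : Bool :=
  g x ^^ g (bxor x a) ^^ g (bxor x b) ^^ g (bxor (bxor x a) b)

/-- Unnormalised Walsh coefficient `W_g(u) = Σ_x (-1)^{g(x) ⊕ u·x}` (the tree's `DerivativeWalsh.W` of `(-1)^g`). -/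
def walshB (g : (Fin n → Bool) → Bool) (u : Fin n → Bool) : ℝ :=
  W (fun x => signOf (g x)) u

/-- `g` is bent on `m + m` bits with dual EXACTLY `f`: `W_g(u) = 2^m · (-1)^{f(u)}` for all `u`
(the content of `forrelation f g = 1`, see `stub_dualPair`). -/
def IsDualPair (m : ℕ) (f g : (Fin (m + m) → Bool) → Bool) : Prop :=
  ∀ u, walshB g u = (2 : ℝ) ^ m * signOf (f u)

/-- `g` is bent on `m + m` bits: `|W_g(u)| = 2^m` for all `u`. -/
def IsBent (m : ℕ) (g : (Fin (m + m) → Bool) → Bool) : Prop :=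
  ∀ u, |walshB g u| = (2 : ℝ) ^ m

/-- An `m`-dimensional subspace `V ≤ 𝔽₂ⁿ`, presented as an injective xor-additive (= 𝔽₂-linear) map
`u : 𝔽₂^m → 𝔽₂ⁿ` with `V = range u`. -/
def IsLinEmb {m n : ℕ} (u : (Fin m → Bool) → (Fin n → Bool)) : Prop :=
  Function.Injective u ∧ ∀ s t, u (bxor s t) = bxor (u s) (u t)

/-- `x ∈ V^⊥` for `V = range u`, the dot product read through the tree's `twist` (`(-1)^{v·x} = 1`). -/
def InPerp {m n : ℕ} (u : (Fin m → Bool) → (Fin n → Bool)) (x : Fin n → Bool) : Prop :=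
  ∀ t, twist (u t) x = 1

/-- Radical count of the direction `a`: `#{b : D_a D_b g is constant} = 2^{dim R_a(g)}`, where `R_a(g)` is the
linear kernel of the quadratic derivative `D_a g` (so `|K_g(a,u)|² ∈ {0, 2ⁿ · #R_a(g)}`, Carlet Prop. 55). -/
def radCount (g : (Fin n → Bool) → Bool) (a : Fin n → Bool) : ℕ :=
  (Finset.univ.filter fun b : Fin n → Bool => ∀ x, D2 g a b x = D2 g a b zeroVec).card

/-- `V = range u` is TOTALLY SINGULAR for the cubic form of `g`: every second derivative along `V` is constant
(phase space: each row `a ∈ V` of `supp K_g` lies in ONE coset of `V^⊥`). -/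
def IsIsotropicFor {m n : ℕ} (g : (Fin n → Bool) → Bool) (u : (Fin m → Bool) → (Fin n → Bool)) : Prop :=
  ∀ s t x, D2 g (u s) (u t) x = D2 g (u s) (u t) zeroVec

/-- `V^⊥` (for `V = range u`) is totally singular for the cubic form of `f` (the column side of the sector). -/
def PerpIsotropicFor {m n : ℕ} (f : (Fin n → Bool) → Bool) (u : (Fin m → Bool) → (Fin n → Bool)) : Prop :=
  ∀ x y, InPerp u x → InPerp u y → ∀ z, D2 f x y z = D2 f x y zeroVec

/-- `V = range u` is a DILLON subspace of `g`: every second derivative along `V` vanishes identically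
(phase space: the rows `a ∈ V` of `supp K_g` lie in the Lagrangian sector `V × V^⊥` itself). -/
def IsDillonFor {m n : ℕ} (g : (Fin n → Bool) → Bool) (u : (Fin m → Bool) → (Fin n → Bool)) : Prop :=
  ∀ s t x, D2 g (u s) (u t) x = false

/-! ### Small certified glue (no sorry) -/

theorem abs_signOf (b : Bool) : |signOf b| = 1 := by
  cases b <;> simp [signOf]

/-- an exact dual pair is in particular bent -/
theorem isBent_of_isDualPair {m : ℕ} {f g : (Fin (m + m) → Bool) → Bool} (h : IsDualPair m f g) :
    IsBent m g := by
  intro u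
  rw [h u, abs_mul, abs_signOf, mul_one]
  exact abs_of_pos (by positivity)

/-- the sandwich `Dillon ⊆ frame`: a Dillon subspace is totally singular -/
theorem isIsotropicFor_of_isDillonFor {m : ℕ} {g : (Fin n → Bool) → Bool}
    {u : (Fin m → Bool) → (Fin n → Bool)} (h : IsDillonFor g u) : IsIsotropicFor g u := by
  intro s t x
  rw [h s t x, h s t zeroVec]

/-! ### Registered stubs -/

/-- STUB 1 (S, known: Cauchy–Schwarz + Parseval; DuttaMaitraMukherjee2024 §3, Rothaus).  `Φ(f,g) = 1` forces
`W_g(u) = 2^m (-1)^{f(u)}` for every `u`: `g` is bent and `f` is EXACTLY its dual.  Honours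
`Disproof.exactPairsMaioranaMcFarland_false_without_forrelation` (the only source of bentness downstream). -/
theorem stub_dualPair {m : ℕ} (f g : (Fin (m + m) → Bool) → Bool) (hΦ : forrelation f g = 1) :
    IsDualPair m f g := by
  sorry

/-- STUB 2 (M, known ingredients: bi-frame covariance `K_g(a,u) = K_f(u,a)` — tree theorem
`DerivativeWalsh.dwt_transpose_of_forrelation_sq_eq_one` — and the plateau structure of quadratic Walsh spectra,
Carlet 2020 Prop. 55 = tree fact `carlet2020_prop55`: `|K_g(a,u)|² ∈ {0, 2ⁿ·#R_a(g)}`).  On the support of the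
Pauli-sector table the radical counts of the row (for `g`) and of the column (for `f`) AGREE. -/
theorem stub_rankMatch {m : ℕ} (f g : (Fin (m + m) → Bool) → Bool) (hf : IsCubic f) (hg : IsCubic g)
    (hd : IsDualPair m f g) :
    ∀ a u, dwt (fun x => signOf (g x)) a u ≠ 0 → radCount g a = radCount f u := by
  sorry

/-- STUB 3 — HARDEST (XL; the trivector half S1, symmetric in the pair).  A cubic exact pair admits a LAGRANGIAN
FRAME: an `m`-dimensional `V` totally singular for the cubic form of `g` whose orthogonal `V^⊥` is totally
singular for the cubic form of `f`.  Input lever: the rank-matched bi-affine incidence `supp K_g` (`hrk`, fed by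
`stub_rankMatch`).  MUST use `hf`: for `(f, g) = (f4, g4)` of `Disproof.lean` (g4 = PP20 `h^10_4`, cubic bent,
quartic dual) no 5-dimensional totally singular `V` exists (relaxed M-index 4), so the conclusion fails —
this is where `exactPairsMaioranaMcFarland_false_without_fCubic` bites.  At `m = 5` the hypothesis "dual cubic"
is equivalent to "every 6-section of the cubic form is non-generic" (triage F1/L3), making this a statement
about trivectors in `∧³𝔽₂¹⁰`. -/
theorem stub_lagrangianFrame {m : ℕ} (f g : (Fin (m + m) → Bool) → Bool) (hf : IsCubic f) (hg : IsCubic g)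
    (hd : IsDualPair m f g)
    (hrk : ∀ a u, dwt (fun x => signOf (g x)) a u ≠ 0 → radCount g a = radCount f u) :
    ∃ u : (Fin m → Bool) → (Fin (m + m) → Bool), IsLinEmb u ∧ IsIsotropicFor g u ∧ PerpIsotropicFor f u := by
  sorry

/-- STUB 4 (L; the constants half S2, "centring the sector").  Given a Lagrangian frame `V` of a cubic exact
pair, SOME `m`-dimensional `V′` is a Dillon subspace of `g` (all second derivatives along `V′` vanish).  In
coordinates `g = c_V(v,v) + v·π(w) + h(w)` with `c_V` the alternating defect form; `c_V = 0` is Dillon; the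
claim is that the defect can always be traded away inside the variety of frames (for `T = 0` this is the
existence of a Lagrangian subspace of a symplectic form, Dickson).  Must use `hg`/`hd` (for the reversed PP20
pair `(g4, f4)` the bent quartic `f4 ∉ MM#` has no Dillon subspace: `Disproof.f4_not_MM`). -/
theorem stub_sectorCentring {m : ℕ} (f g : (Fin (m + m) → Bool) → Bool) (hf : IsCubic f) (hg : IsCubic g)
    (hd : IsDualPair m f g) (u : (Fin m → Bool) → (Fin (m + m) → Bool)) (hu : IsLinEmb u)
    (hV : IsIsotropicFor g u) (hV' : PerpIsotropicFor f u) :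
    ∃ v : (Fin m → Bool) → (Fin (m + m) → Bool), IsLinEmb v ∧ IsDillonFor g v := by
  sorry

/-- STUB 5 (M, known: Dillon 1974 / Carlet 2020 — the `⇐` half of Dillon's MM#-criterion, i.e. the
SectorCriterion of the idea card read towards the crux).  A BENT `g` on `m + m` bits that is affine on every
coset of an `m`-dimensional subspace `V` (all `D_aD_b g ≡ 0`, `a b ∈ V`) is, after a LINEAR change of variables
`e` (so `c = 0` in the affine witness), in Maiorana–McFarland normal form `y′·perm(y″) + h(y″)`; bentness is
what makes `perm` a bijection (cf. `Disproof.zero_not_MM`). -/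
theorem stub_dillonCriterion {m : ℕ} (g : (Fin (m + m) → Bool) → Bool) (hb : IsBent m g)
    (v : (Fin m → Bool) → (Fin (m + m) → Bool)) (hv : IsLinEmb v) (hD : IsDillonFor g v) :
    MMConclusionAt m g := by
  sorry

/-! ### Composition (kernel-checked) -/

/-- **The composition with the five stub STATEMENTS as hypotheses** (sorry-free, axioms ⊆ {propext, choice,
quot.sound}): dual pair ⇒ rank-matched Pauli-sector table ⇒ Lagrangian frame ⇒ centred sector (Dillon subspace)
⇒ MM normal form (bentness from the dual pair).  Concludes the crux BODY (`Negative.exactPairsMaioranaMcFarland_iff`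
is `Iff.rfl`). -/
theorem mm_of_parts
    (h1 : ∀ (m : ℕ) (f g : (Fin (m + m) → Bool) → Bool), forrelation f g = 1 → IsDualPair m f g)
    (h2 : ∀ (m : ℕ) (f g : (Fin (m + m) → Bool) → Bool), IsCubic f → IsCubic g → IsDualPair m f g →
        ∀ a u, dwt (fun x => signOf (g x)) a u ≠ 0 → radCount g a = radCount f u)
    (h3 : ∀ (m : ℕ) (f g : (Fin (m + m) → Bool) → Bool), IsCubic f → IsCubic g → IsDualPair m f g →
        (∀ a u, dwt (fun x => signOf (g x)) a u ≠ 0 → radCount g a = radCount f u) →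
        ∃ u : (Fin m → Bool) → (Fin (m + m) → Bool), IsLinEmb u ∧ IsIsotropicFor g u ∧ PerpIsotropicFor f u)
    (h4 : ∀ (m : ℕ) (f g : (Fin (m + m) → Bool) → Bool), IsCubic f → IsCubic g → IsDualPair m f g →
        ∀ u : (Fin m → Bool) → (Fin (m + m) → Bool), IsLinEmb u → IsIsotropicFor g u →
        PerpIsotropicFor f u →
        ∃ v : (Fin m → Bool) → (Fin (m + m) → Bool), IsLinEmb v ∧ IsDillonFor g v)
    (h5 : ∀ (m : ℕ) (g : (Fin (m + m) → Bool) → Bool), IsBent m g →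
        ∀ v : (Fin m → Bool) → (Fin (m + m) → Bool), IsLinEmb v → IsDillonFor g v → MMConclusionAt m g) :
    ∀ (m : ℕ) (f g : (Fin (m + m) → Bool) → Bool), IsCubic f → IsCubic g → forrelation f g = 1 →
      MMConclusionAt m g := by
  intro m f g hf hg hΦ
  have hd : IsDualPair m f g := h1 m f g hΦ
  have hrk := h2 m f g hf hg hd
  obtain ⟨u, hu, hV, hV'⟩ := h3 m f g hf hg hd hrk
  obtain ⟨v, hv, hD⟩ := h4 m f g hf hg hd u hu hV hV'
  exact h5 m g (isBent_of_isDualPair hd) v hv hD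

/-- **THE COMPOSITION.** The crux `CubicForrelation.ExactPairsMaioranaMcFarland` BY NAME from the five registered
stubs (`sorry` lives only inside `stub_*`). -/
theorem ExactPairsMaioranaMcFarland_of : ExactPairsMaioranaMcFarland :=
  exactPairsMaioranaMcFarland_iff.2
    (mm_of_parts
      (fun m f g h => stub_dualPair f g h)
      (fun m f g hf hg hd => stub_rankMatch f g hf hg hd)
      (fun m f g hf hg hd hrk => stub_lagrangianFrame f g hf hg hd hrk)
      (fun m f g hf hg hd u hu hV hV' => stub_sectorCentring f g hf hg hd u hu hV hV')
      (fun m g hb v hv hD => stub_dillonCriterion g hb v hv hD))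

/-- Phase-space datum available to the provers of STUB 2/3 for free: the two Pauli-sector tables of an exact
pair are transposes (tree theorem; here just re-exported in the line's vocabulary). -/
theorem covariance_of_forrelation {m : ℕ} (f g : (Fin (m + m) → Bool) → Bool) (hΦ : forrelation f g = 1)
    (a u : Fin (m + m) → Bool) :
    dwt (fun y => signOf (g y)) u a = dwt (fun x => signOf (f x)) a u :=
  dwt_transpose_of_forrelation_sq_eq_one f g (by rw [hΦ, one_pow]) a u

end Summit.QuantumAdvantage.QuantumAdvantage.Cruxes.ExactPairsMaioranaMcFarland.LagrangianPauliSector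

end
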